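import Mathlib

/-!
# «BOMBIERI (iii) IS A HEIGHT STATEMENT» — typed statement sketch (rh-idea-3 g2, 2026-08-28; K-task head start, NOT a proposal)

Bombieri 2000 («Remarks on Weil's quadratic functional I», Thm 11 + Corollary, pp.36–37): if ζ has finitely many but ≥ 1
zeros off the line and Weil's form is non-negative on test functions supported in `𝓔 = exp E`, then the exponentials
`u ↦ e^{-iγu}` over the zero «ordinates» `γ` (`ζ(1/2 + iγ) = 0`, complex `γ` for off-line zeros) admit an ℓ²-relation on `E`
with at least half of the coefficient mass on the off-line ordinates.  `BombieriRelationOn T` types that conclusion on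
`E = [-T, T]` (Corollary form: half mass off-line; series understood as L²(E)-limit of partial sums in some enumeration).
`WeilVariationalSoftness` is the soft lemma of A-SEARCH-NB.md §2: ONE off-line zero of height ≥ g₀(T) already forces the
relation (over-completeness of the on-line exponentials: Kadec near part + Beurling frame far part).  The two `theorem`s are
the bookkeeping consequences: «no relation on [-T,T]» is a HEIGHT statement, and it is implied by RH (proved here outright).
Nothing here bears on the truth of RH.
-/

noncomputable section
open Complex MeasureTheory

-- D-0017: `Summit.RiemannHypothesis.RiemannHypothesis.…` duplicates the namespace BY DESIGN (single-problem summit).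
set_option linter.dupNamespace false

namespace Summit.RiemannHypothesis.RiemannHypothesis.Theorems.WeilVariationalSoftness

/-- `γ` is a zero ordinate in Bombieri's sense: `ζ(1/2 + iγ) = 0` with `1/2 + iγ` in the open critical strip
(so trivial zeros are excluded; `γ ∈ ℝ` iff the zero is on the critical line). -/
def IsZeroOrdinate (γ : ℂ) : Prop :=
  riemannZeta (1 / 2 + I * γ) = 0 ∧ 0 < (1 / 2 + I * γ).re ∧ (1 / 2 + I * γ).re < 1

/-- Bombieri's alternative (iii) on `E = [-T, T]` (Corollary form): distinct zero ordinates `γ n` and coefficients `z n`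
with `∑ ‖z n‖² = 1`, at least half of that mass on NON-REAL ordinates (off-line zeros), and partial sums of
`∑ z n · e^{-i γ n u}` tending to `0` in `L²[-T, T]`. -/
def BombieriRelationOn (T : ℝ) : Prop :=
  ∃ (γ : ℕ → ℂ) (z : ℕ → ℂ),
    Function.Injective γ ∧ (∀ n, IsZeroOrdinate (γ n)) ∧
    Summable (fun n => ‖z n‖ ^ 2) ∧ ∑' n, ‖z n‖ ^ 2 = 1 ∧
    (1 / 2 : ℝ) ≤ ∑' n, (if (γ n).im = 0 then 0 else ‖z n‖ ^ 2) ∧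
    Filter.Tendsto
      (fun N : ℕ => ∫ u in Set.Icc (-T) T, ‖∑ n ∈ Finset.range N, z n * cexp (-(I * γ n * (u : ℂ)))‖ ^ 2)
      Filter.atTop (nhds 0)

/-- THE SOFT LEMMA (A-SEARCH-NB.md §2; to be proved from Kadec ¼ + Beurling's sampling theorem + Littlewood's gap theorem):
for every `T > 0` there is a height `g₀` such that a single off-line zero of height ≥ `g₀` forces Bombieri's relation on `[-T,T]`. -/
def WeilVariationalSoftness : Prop :=
  ∀ T : ℝ, 0 < T → ∃ g₀ : ℝ, ∀ ρ : ℂ,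
    riemannZeta ρ = 0 → 0 < ρ.re → ρ.re < 1 → ρ.re ≠ 1 / 2 → g₀ ≤ |ρ.im| → BombieriRelationOn T

/-- Bookkeeping 1: under the soft lemma, «no Bombieri relation on [-T,T]» is a HEIGHT statement —
every off-line zero lies below height `g₀(T)`. -/
theorem offline_height_bound_of_noRelation (h : WeilVariationalSoftness) {T : ℝ} (hT : 0 < T) :
    ∃ g₀ : ℝ, ¬ BombieriRelationOn T →
      ∀ ρ : ℂ, riemannZeta ρ = 0 → 0 < ρ.re → ρ.re < 1 → ρ.re ≠ 1 / 2 → |ρ.im| < g₀ := by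
  obtain ⟨g₀, hg⟩ := h T hT
  refine ⟨g₀, fun hno ρ h0 h1 h2 h3 => ?_⟩
  by_contra hlt
  exact hno (hg ρ h0 h1 h2 h3 (not_lt.mp hlt))

/-- Bookkeeping 2 (unconditional): RH ⇒ no Bombieri relation on any `[-T,T]` — under RH every zero ordinate is real, so the
off-line mass is `0 < 1/2`.  Hence `¬ BombieriRelationOn T` is RH-implied AND (by Bookkeeping 1 + Bombieri's theorem for
short `T`) ¬RH-refuted: for `T` in the positivity range it is RH itself. -/
theorem noRelation_of_rh (hRH : RiemannHypothesis) (T : ℝ) : ¬ BombieriRelationOn T := by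
  rintro ⟨γ, z, _, hγ, _, _, hhalf, _⟩
  have hre : ∀ n, (γ n).im = 0 := by
    intro n
    obtain ⟨hz, h0, h1⟩ := hγ n
    have e : (1 / 2 + I * γ n).re = 1 / 2 - (γ n).im := by simp; ring
    have hne1 : (1 / 2 + I * γ n) ≠ 1 := by
      intro h; rw [h] at h1; simp at h1
    have htriv : ¬ ∃ k : ℕ, (1 / 2 + I * γ n) = -2 * (k + 1) := by
      rintro ⟨k, hk⟩
      rw [hk] at h0
      have hk0 : (0 : ℝ) ≤ k := Nat.cast_nonneg k
      have : ((-2 : ℂ) * ((k : ℂ) + 1)).re = -2 * ((k : ℝ) + 1) := by simp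
      rw [this] at h0; linarith
    have h12 := hRH (1 / 2 + I * γ n) hz htriv hne1
    rw [e] at h12; linarith
  have : ∑' n, (if (γ n).im = 0 then (0 : ℝ) else ‖z n‖ ^ 2) = 0 := by
    simp [hre]
  linarith

end Summit.RiemannHypothesis.RiemannHypothesis.Theorems.WeilVariationalSoftness
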